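import Summits.NavierStokesRegularity.NavierStokesRegularity.Theorems.PerpetualPumpCircuitTraceQuietImpliesRegularMP

/-!
# `PerpetualPump.CircuitTrace` (stmt-NavierStokesRegularity-1836), line `tilted-trace-gronwall`:
# stub S2b `quietImpliesRegular` — part II, the weighted maximum principle and `θ ↑ 1`

Helper file (kind = proof) proving the registered stub `stub_quietImpliesRegular` of the lead's
skeleton for crux `PerpetualPump.CircuitTrace` (Tao's viscous dyadic circuit (4.3) at `α = 2/5`,
`circuitRHS` of `Theorems/CircuitTrace/Negative/LoadBearing.lean`): there is
`ε₀ = ε₀(lam, m, coeff) > 0` such that an `ε₀`-quiet half-line of scales `{j ≥ n}` on `[t₁, T)`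
forces the `H¹⁰` weight `lam^{4j}|X_{i,j}|` to stay bounded on `[0, T)`.

* `quietImpliesRegular_firstTouch` — the generic first-touching-time argument for finitely many
  continuous functions on `[a, b]` below a level `M` at `a`;
* `quietImpliesRegular_deriv_nonneg` — a function strictly below its value at `c` on `[a, c)`
  has derivative `≥ 0` at `c`;
* `quietImpliesRegular_mp` — the weighted maximum principle at fixed `θ ∈ (0,1)` for the weights
  `θ^j lam^{4j}|X_{i,j}|`, `j > n` (finiteness of the candidate set from the a-priori `H¹⁰` bound;
  the sign at a touching time is part I, `PerpetualPumpCircuitTraceQuietImpliesRegularMP.lean`);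
* `quietImpliesRegular_le_of_forall_theta` — the limit `θ ↑ 1`;
* `stub_quietImpliesRegular` — assembly (`[0,t₁]`: a-priori bound; `j < 0`: no modes;
  `0 ≤ j ≤ n`: critical amplitude bound; `j > n` on `[t₁,T)`: the maximum principle). [folklore]
-/

set_option linter.dupNamespace false

noncomputable section

namespace Summit.NavierStokesRegularity.NavierStokesRegularity.Theorems.PerpetualPumpCircuitTrace

open Finset Real Set Filter Topology
open Summit.NavierStokesRegularity.NavierStokesRegularity.Theorems.CircuitTrace.Negative

/-- **First touching time.** Finitely many functions `f k`, `k ∈ S`, continuous on `[a, b]` and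
`< M` at `a`, stay `< M` on all of `[a, b]` provided no "first touch" is possible: there is no
time `t ∈ (a, b]` and `k ∈ S` with `f k t = M`, all `f k' t ≤ M`, and all `f k' < M` on `[a, t)`.
(Proof: the infimum of the closed set of bad times is such a first touch, by the intermediate
value theorem.) [folklore] -/
theorem quietImpliesRegular_firstTouch {ι : Type*} (S : Finset ι) (f : ι → ℝ → ℝ) {a b M : ℝ}
    (hcont : ∀ k ∈ S, ContinuousOn (f k) (Set.Icc a b)) (ha : ∀ k ∈ S, f k a < M)
    (hno : ∀ t ∈ Set.Ioc a b, ∀ k ∈ S, (∀ k' ∈ S, f k' t ≤ M) →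
      (∀ k' ∈ S, ∀ s ∈ Set.Ico a t, f k' s < M) → f k t = M → False) :
    ∀ k ∈ S, ∀ t ∈ Set.Icc a b, f k t < M := by
  by_contra hcon
  push Not at hcon
  obtain ⟨k₀, hk₀, t₀, ht₀, hge⟩ := hcon
  set Bad : Set ℝ := ⋃ k ∈ S, (Set.Icc a b ∩ f k ⁻¹' Set.Ici M) with hBad
  have hmem : ∀ t, t ∈ Bad ↔ ∃ k ∈ S, t ∈ Set.Icc a b ∧ M ≤ f k t := by
    intro t
    simp only [hBad, Set.mem_iUnion, Set.mem_inter_iff, Set.mem_preimage, Set.mem_Ici,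
      exists_prop]
  have hclosed : IsClosed Bad :=
    isClosed_biUnion_finset fun k hk =>
      (hcont k hk).preimage_isClosed_of_isClosed isClosed_Icc isClosed_Ici
  have hne : Bad.Nonempty := ⟨t₀, (hmem t₀).2 ⟨k₀, hk₀, ht₀, hge⟩⟩
  have hbdd : BddBelow Bad := ⟨a, fun t ht => by
    obtain ⟨_, _, htI, _⟩ := (hmem t).1 ht
    exact htI.1⟩
  set c := sInf Bad with hc
  obtain ⟨k, hk, hcI, hck⟩ := (hmem c).1 (hclosed.csInf_mem hne hbdd)
  -- minimality of `c`
  have hbefore : ∀ k' ∈ S, ∀ s ∈ Set.Ico a c, f k' s < M := by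
    intro k' hk' s hs
    by_contra hh
    push Not at hh
    have hsBad : s ∈ Bad := (hmem s).2 ⟨k', hk', ⟨hs.1, hs.2.le.trans hcI.2⟩, hh⟩
    have := csInf_le hbdd hsBad
    linarith [hs.2]
  -- at `c` every function is `≤ M` (intermediate value theorem on `[a, c]`)
  have hall : ∀ k' ∈ S, f k' c ≤ M := by
    intro k' hk'
    by_contra hh
    push Not at hh
    obtain ⟨s, hs, hsM⟩ := intermediate_value_Icc hcI.1
      ((hcont k' hk').mono (Set.Icc_subset_Icc_right hcI.2)) ⟨(ha k' hk').le, hh.le⟩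
    rcases eq_or_lt_of_le hs.2 with hsc | hsc
    · rw [hsc] at hsM
      linarith
    · have := hbefore k' hk' s ⟨hs.1, hsc⟩
      linarith
  have hkeq : f k c = M := le_antisymm (hall k hk) hck
  have hac : a < c := by
    rcases eq_or_lt_of_le hcI.1 with h | h
    · have := ha k hk
      rw [h] at this
      linarith
    · exact h
  exact hno c ⟨hac, hcI.2⟩ k hk hall hbefore hkeq

/-- **One-sided Fermat.** If `g` is differentiable at `c` and `g < g c` on `[a, c)` (`a < c`),
then `g' (c) ≥ 0` (left difference quotients are positive). [folklore] -/
theorem quietImpliesRegular_deriv_nonneg {g : ℝ → ℝ} {g' a c : ℝ} (hac : a < c)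
    (hg : HasDerivAt g g' c) (hlt : ∀ s ∈ Set.Ico a c, g s < g c) : 0 ≤ g' := by
  have ht : Tendsto (slope g c) (𝓝[<] c) (𝓝 g') :=
    (hasDerivAt_iff_tendsto_slope.1 hg).mono_left (nhdsWithin_mono _ fun x hx => ne_of_lt hx)
  refine ge_of_tendsto ht ?_
  filter_upwards [Ico_mem_nhdsLT hac] with s hs
  rw [slope_def_field]
  exact (div_pos_of_neg_of_neg (by linarith [hlt s hs]) (by linarith [hs.2])).le

/-- **The weighted maximum principle at fixed `θ ∈ (0,1)`.** Let `X` solve the circuit on `(0,T)`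
with the a-priori `H¹⁰` bound on every `[0,T']`, `T' < T`; let every mode at scales `j ≥ n`
(`n ≥ 0`) be `ε`-quiet in critical units on `[t₁, T)`, with `4m²Kε lam^{16/5} ≤ 1/2`; let the
level `W` exceed twice the valve forcing `β₂ = 4m²Kε² lam^{(19n+16)/5}` and the unweighted
`H¹⁰` size `lam^{4j}|X_{i,j}(t₁)|` of every block mode `j > n` at time `t₁`. Then the weights
`θ^j lam^{4j}|X_{i,j}(t)|`, `j > n`, stay `< W` on `[t₁, T)`. Proof: on `[t₁, t₀]` the a-priori
bound `lam^{4j}|X| ≤ C''` leaves only the finitely many modes `n < j ≤ n + N` (`θ^N (C''⁺+1) < W`)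
as candidates; at a first touching time the touched mode would have `X Ẋ < 0`
(`quietImpliesRegular_sign`) yet `d(X²)/dt ≥ 0` (`quietImpliesRegular_deriv_nonneg`). [folklore] -/
theorem quietImpliesRegular_mp {lam : ℝ} (hlam : 1 < lam) {m : ℕ}
    (coeff : Fin m → Fin m → Fin m → Option (Fin 3) → ℝ) {K : ℝ} (hK0 : 0 ≤ K)
    (hK : ∀ i₁ i₂ i₃ μ, |coeff i₁ i₂ i₃ μ| ≤ K) {T : ℝ} (X : Fin m → ℤ → ℝ → ℝ)
    (hderiv : ∀ (i : Fin m) (n : ℤ), ∀ t ∈ Set.Ioo 0 T,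
      HasDerivAt (X i n) (circuitRHS lam coeff X i n t) t)
    (hapr : ∀ T' ∈ Set.Ioo 0 T, ∃ C : ℝ, ∀ (i : Fin m) (n : ℤ), ∀ t ∈ Set.Icc 0 T',
      lam ^ ((4 : ℝ) * n) * |X i n t| ≤ C)
    {n : ℤ} (hn : 0 ≤ n) {t₁ : ℝ} (ht₁ : t₁ ∈ Set.Ioo 0 T) {ε : ℝ} (hε0 : 0 ≤ ε)
    (hquiet : ∀ (i : Fin m) (j : ℤ), n ≤ j → ∀ t ∈ Set.Ico t₁ T,
      lam ^ ((1 / 5 : ℝ) * j) * |X i j t| ≤ ε)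
    (hη : 4 * (m : ℝ) ^ 2 * K * ε * lam ^ (16 / 5 : ℝ) ≤ 1 / 2) {W : ℝ}
    (hWβ : 2 * (4 * (m : ℝ) ^ 2 * K * (ε ^ 2 * lam ^ (((19 : ℝ) * n + 16) / 5))) < W)
    (hinit : ∀ (i : Fin m) (j : ℤ), n < j → lam ^ ((4 : ℝ) * j) * |X i j t₁| < W)
    {θ : ℝ} (hθ0 : 0 < θ) (hθ1 : θ < 1) :
    ∀ (i : Fin m) (j : ℤ), n < j → ∀ t ∈ Set.Ico t₁ T,
      θ ^ (j : ℝ) * (lam ^ ((4 : ℝ) * j) * |X i j t|) < W := by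
  have hlam0 : 0 < lam := by linarith
  have hW0 : 0 < W := by
    have : 0 ≤ 4 * (m : ℝ) ^ 2 * K * (ε ^ 2 * lam ^ (((19 : ℝ) * n + 16) / 5)) := by positivity
    linarith
  have hθle : ∀ {k : ℤ}, n < k → θ ^ (k : ℝ) ≤ 1 := fun hk =>
    Real.rpow_le_one hθ0.le hθ1.le (by exact_mod_cast (by omega : (0 : ℤ) ≤ _))
  intro i₀ j₀ hj₀ t₀ ht₀
  have ht₀' : t₀ ∈ Set.Ioo 0 T := ⟨lt_of_lt_of_le ht₁.1 ht₀.1, ht₀.2⟩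
  -- the a-priori bound up to `t₀` leaves finitely many candidate modes on `[t₁, t₀]`
  obtain ⟨C'', hC''⟩ := hapr t₀ ht₀'
  obtain ⟨N, hN⟩ := exists_pow_lt_of_lt_one (show 0 < W / (max C'' 0 + 1) by positivity) hθ1
  have hfar : ∀ (i : Fin m) (k : ℤ), n + N < k → ∀ s ∈ Set.Icc t₁ t₀,
      θ ^ (k : ℝ) * (lam ^ ((4 : ℝ) * k) * |X i k s|) < W := by
    intro i k hk s hs
    have h1 : lam ^ ((4 : ℝ) * k) * |X i k s| ≤ max C'' 0 :=
      (hC'' i k s ⟨by linarith [hs.1, ht₁.1], hs.2⟩).trans (le_max_left _ _)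
    have h2 : θ ^ (k : ℝ) ≤ θ ^ N := by
      rw [← Real.rpow_natCast]
      exact Real.rpow_le_rpow_of_exponent_ge hθ0 hθ1.le
        (by exact_mod_cast (by omega : (N : ℤ) ≤ k))
    have h3 : θ ^ N * (max C'' 0 + 1) < W := by rwa [lt_div_iff₀ (by positivity)] at hN
    have h4 : 0 ≤ θ ^ N := pow_nonneg hθ0.le N
    calc θ ^ (k : ℝ) * (lam ^ ((4 : ℝ) * k) * |X i k s|) ≤ θ ^ N * max C'' 0 :=
          mul_le_mul h2 h1 (by positivity) h4
      _ ≤ θ ^ N * (max C'' 0 + 1) := by nlinarith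
      _ < W := h3
  -- the candidates and their weights
  set S : Finset (Fin m × ℤ) := Finset.univ ×ˢ Finset.Ioc n (n + N) with hS
  set f : Fin m × ℤ → ℝ → ℝ := fun p s =>
    θ ^ (p.2 : ℝ) * (lam ^ ((4 : ℝ) * p.2) * |X p.1 p.2 s|) with hf
  have hmemS : ∀ p : Fin m × ℤ, p ∈ S ↔ n < p.2 ∧ p.2 ≤ n + N := by
    intro p
    simp [hS, Finset.mem_product, Finset.mem_Ioc]
  have hmain : ∀ p ∈ S, ∀ s ∈ Set.Icc t₁ t₀, f p s < W := by
    refine quietImpliesRegular_firstTouch S f ?_ ?_ ?_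
    · -- continuity on `[t₁, t₀] ⊆ (0, T)`
      rintro ⟨i, k⟩ _ s hs
      have hs' : s ∈ Set.Ioo 0 T := ⟨by linarith [hs.1, ht₁.1], lt_of_le_of_lt hs.2 ht₀.2⟩
      have hc : ContinuousAt (X i k) s := (hderiv i k s hs').continuousAt
      show ContinuousWithinAt (fun s => θ ^ (k : ℝ) * (lam ^ ((4 : ℝ) * k) * |X i k s|))
        (Set.Icc t₁ t₀) s
      exact (continuousAt_const.mul (continuousAt_const.mul hc.abs)).continuousWithinAt
    · -- below the level at `t₁`
      rintro ⟨i, k⟩ hp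
      have hk : n < k := ((hmemS _).1 hp).1
      show θ ^ (k : ℝ) * (lam ^ ((4 : ℝ) * k) * |X i k t₁|) < W
      calc θ ^ (k : ℝ) * (lam ^ ((4 : ℝ) * k) * |X i k t₁|)
          ≤ 1 * (lam ^ ((4 : ℝ) * k) * |X i k t₁|) :=
            mul_le_mul_of_nonneg_right (hθle hk) (by positivity)
        _ < W := by rw [one_mul]; exact hinit i k hk
    · -- no first touch
      rintro s hs ⟨i, k⟩ hp hall hbefore heq
      have hk : n < k := ((hmemS _).1 hp).1
      have hs' : s ∈ Set.Ioo 0 T := ⟨by linarith [hs.1, ht₁.1], lt_of_le_of_lt hs.2 ht₀.2⟩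
      have hsIco : s ∈ Set.Ico t₁ T := ⟨hs.1.le, hs'.2⟩
      have hwt : ∀ (i' : Fin m) (k' : ℤ), n < k' →
          θ ^ (k' : ℝ) * (lam ^ ((4 : ℝ) * k') * |X i' k' s|) ≤ W := by
        intro i' k' hk'
        by_cases hkN : k' ≤ n + N
        · exact hall (i', k') ((hmemS _).2 ⟨hk', hkN⟩)
        · exact (hfar i' k' (by omega) s ⟨hs.1.le, hs.2⟩).le
      have heq' : θ ^ (k : ℝ) * (lam ^ ((4 : ℝ) * k) * |X i k s|) = W := heq
      have hsign := quietImpliesRegular_sign lam hlam m coeff K hK0 hK X s n k hn hk ε hε0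
        (fun i' k' hk' => hquiet i' k' hk' s hsIco) θ hθ0 hθ1.le W hwt hη hWβ i heq'
      -- yet `X_{i,k}²` is strictly below its value at `s` just before `s`
      have hX := hderiv i k s hs'
      have hlt : ∀ u ∈ Set.Ico t₁ s, X i k u * X i k u < X i k s * X i k s := by
        intro u hu
        have h1 : θ ^ (k : ℝ) * (lam ^ ((4 : ℝ) * k) * |X i k u|) <
            θ ^ (k : ℝ) * (lam ^ ((4 : ℝ) * k) * |X i k s|) := by
          rw [heq']
          exact hbefore (i, k) hp u hu
        have h2 : |X i k u| < |X i k s| :=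
          lt_of_mul_lt_mul_left (lt_of_mul_lt_mul_left h1 (Real.rpow_pos_of_pos hθ0 _).le)
            (Real.rpow_pos_of_pos hlam0 _).le
        rw [← abs_mul_abs_self, ← abs_mul_abs_self (X i k s)]
        exact mul_self_lt_mul_self (abs_nonneg _) h2
      have hder := quietImpliesRegular_deriv_nonneg hs.1 (hX.mul hX) hlt
      nlinarith [hsign, hder]
  by_cases hjN : j₀ ≤ n + N
  · exact hmain (i₀, j₀) ((hmemS _).2 ⟨hj₀, hjN⟩) t₀ ⟨ht₀.1, le_rfl⟩
  · exact hfar i₀ j₀ (by omega) t₀ ⟨ht₀.1, le_rfl⟩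

/-- **The limit `θ ↑ 1`.** If `θ^j V < W` for every `θ ∈ (0,1)`, then `V ≤ W`. [folklore] -/
theorem quietImpliesRegular_le_of_forall_theta {V W : ℝ} {j : ℤ}
    (h : ∀ θ : ℝ, 0 < θ → θ < 1 → θ ^ (j : ℝ) * V < W) : V ≤ W := by
  have hcont : Tendsto (fun θ : ℝ => θ ^ (j : ℝ) * V) (𝓝[<] 1) (𝓝 V) := by
    have h1 : ContinuousAt (fun θ : ℝ => θ ^ (j : ℝ) * V) 1 :=
      (Real.continuousAt_rpow_const 1 (j : ℝ) (Or.inl one_ne_zero)).mul continuousAt_const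
    have h2 := h1.tendsto
    simp only [Real.one_rpow, one_mul] at h2
    exact h2.mono_left nhdsWithin_le_nhds
  refine le_of_tendsto hcont ?_
  filter_upwards [Ioo_mem_nhdsLT zero_lt_one] with θ hθ
  exact (h θ hθ.1 hθ.2).le

/-- **S2b: an `ε₀`-quiet half-line is `H¹⁰`-regular** (stub `stub_quietImpliesRegular` of the
line `tilted-trace-gronwall` for crux `PerpetualPump.CircuitTrace`). There is
`ε₀ = ε₀(lam, m, coeff) > 0` (`ε₀ = 1/(8(K+1)(m+1)² lam^{16/5})`, `K` a bound on the structure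
constants) such that: if every mode at every scale `j ≥ n` (`n ≥ 0`) is `ε₀`-quiet in critical
units on `[t₁, T)`, `t₁ ∈ (0, T)`, then `sup_{i,j,[0,T)} lam^{4j}|X_{i,j}| < ∞`. Proof: on `[0, t₁]`
the a-priori bound; scales `j < 0` vanish; scales `0 ≤ j ≤ n` by `a ≤ A`
(`lam^{4j}|X| = lam^{19j/5} a ≤ lam^{19n/5} A⁺`); the block `j > n` on `[t₁, T)` by the weighted
maximum principle `quietImpliesRegular_mp` at every `θ ∈ (0,1)` with the `θ`-independent level
`W = max(C_{t₁}⁺, 2β₂) + 1`, and `θ ↑ 1`. [folklore] -/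
theorem stub_quietImpliesRegular :
    ∀ lam : ℝ, 1 < lam → ∀ (m : ℕ) (coeff : Fin m → Fin m → Fin m → Option (Fin 3) → ℝ) (A : ℝ),
    ∃ ε₀ : ℝ, 0 < ε₀ ∧ ∀ (T : ℝ) (X : Fin m → ℤ → ℝ → ℝ), 0 < T →
    (∀ (i : Fin m) (n : ℤ), ∀ t ∈ Set.Ioo 0 T, HasDerivAt (X i n) (circuitRHS lam coeff X i n t) t) →
    (∀ (i : Fin m) (n : ℤ) (t : ℝ), n < 0 → X i n t = 0) →
    (∀ T' ∈ Set.Ioo 0 T, ∃ C : ℝ, ∀ (i : Fin m) (n : ℤ), ∀ t ∈ Set.Icc 0 T',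
      lam ^ ((4 : ℝ) * n) * |X i n t| ≤ C) →
    (∀ t ∈ Set.Ico 0 T, ∀ (i : Fin m) (n : ℤ), lam ^ ((1 / 5 : ℝ) * n) * |X i n t| ≤ A) →
    ∀ n : ℤ, 0 ≤ n → ∀ t₁ ∈ Set.Ioo 0 T,
    (∀ (i : Fin m) (j : ℤ), n ≤ j → ∀ t ∈ Set.Ico t₁ T, lam ^ ((1 / 5 : ℝ) * j) * |X i j t| ≤ ε₀) →
    ∃ C : ℝ, ∀ (i : Fin m) (j : ℤ), ∀ t ∈ Set.Ico 0 T, lam ^ ((4 : ℝ) * j) * |X i j t| ≤ C := by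
  intro lam hlam m coeff A
  have hlam0 : 0 < lam := by linarith
  obtain ⟨K, hK0, hK⟩ := exists_coeff_bound coeff
  have hL0 : 0 < lam ^ (16 / 5 : ℝ) := Real.rpow_pos_of_pos hlam0 _
  have hD : 0 < 8 * (K + 1) * ((m : ℝ) + 1) ^ 2 * lam ^ (16 / 5 : ℝ) := by positivity
  set ε₀ := 1 / (8 * (K + 1) * ((m : ℝ) + 1) ^ 2 * lam ^ (16 / 5 : ℝ)) with hε₀
  have hε₀0 : 0 < ε₀ := by positivity
  have hη : 4 * (m : ℝ) ^ 2 * K * ε₀ * lam ^ (16 / 5 : ℝ) ≤ 1 / 2 := by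
    have hD1 : ε₀ * (8 * (K + 1) * ((m : ℝ) + 1) ^ 2 * lam ^ (16 / 5 : ℝ)) = 1 := by
      rw [hε₀, one_div, inv_mul_cancel₀ hD.ne']
    have h1 : (m : ℝ) ^ 2 * K ≤ ((m : ℝ) + 1) ^ 2 * (K + 1) :=
      mul_le_mul (by nlinarith [(Nat.cast_nonneg m : (0 : ℝ) ≤ m)]) (by linarith) hK0
        (by positivity)
    calc 4 * (m : ℝ) ^ 2 * K * ε₀ * lam ^ (16 / 5 : ℝ)
        = 4 * ((m : ℝ) ^ 2 * K) * (ε₀ * lam ^ (16 / 5 : ℝ)) := by ring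
      _ ≤ 4 * (((m : ℝ) + 1) ^ 2 * (K + 1)) * (ε₀ * lam ^ (16 / 5 : ℝ)) := by gcongr
      _ = 1 / 2 * (ε₀ * (8 * (K + 1) * ((m : ℝ) + 1) ^ 2 * lam ^ (16 / 5 : ℝ))) := by ring
      _ = 1 / 2 := by rw [hD1, mul_one]
  refine ⟨ε₀, hε₀0, ?_⟩
  intro T X _hT hderiv hcut hapr hA n hn t₁ ht₁ hquiet
  obtain ⟨C₁, hC₁⟩ := hapr t₁ ht₁
  set β₂ := 4 * (m : ℝ) ^ 2 * K * (ε₀ ^ 2 * lam ^ (((19 : ℝ) * n + 16) / 5)) with hβ₂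
  set W := max (max C₁ 0) (2 * β₂) + 1 with hW
  have hWβ : 2 * β₂ < W := by
    have := le_max_right (max C₁ 0) (2 * β₂)
    linarith
  have hWC : max C₁ 0 < W := by
    have := le_max_left (max C₁ 0) (2 * β₂)
    linarith
  have hinit : ∀ (i : Fin m) (j : ℤ), n < j → lam ^ ((4 : ℝ) * j) * |X i j t₁| < W :=
    fun i j _ => lt_of_le_of_lt ((hC₁ i j t₁ ⟨ht₁.1.le, le_rfl⟩).trans (le_max_left _ _)) hWC
  have hblock : ∀ (i : Fin m) (j : ℤ), n < j → ∀ t ∈ Set.Ico t₁ T,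
      lam ^ ((4 : ℝ) * j) * |X i j t| ≤ W := fun i j hj t ht =>
    quietImpliesRegular_le_of_forall_theta fun θ hθ0 hθ1 =>
      quietImpliesRegular_mp hlam coeff hK0 hK X hderiv hapr hn ht₁ hε₀0.le hquiet hη hWβ hinit
        hθ0 hθ1 i j hj t ht
  refine ⟨max (max (max C₁ 0) W) (lam ^ ((19 / 5 : ℝ) * n) * max A 0), ?_⟩
  intro i j t ht
  by_cases hj0 : j < 0
  · rw [hcut i j t hj0, abs_zero, mul_zero]
    exact le_trans (le_trans (le_max_right C₁ 0) (le_max_left _ _)) (le_max_left _ _)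
  push Not at hj0
  by_cases htt : t ≤ t₁
  · exact le_trans (le_trans (le_trans (hC₁ i j t ⟨ht.1, htt⟩) (le_max_left _ _))
      (le_max_left _ _)) (le_max_left _ _)
  push Not at htt
  by_cases hj : n < j
  · exact le_trans (le_trans (hblock i j hj t ⟨htt.le, ht.2⟩) (le_max_right _ _))
      (le_max_left _ _)
  push Not at hj
  -- low scales `0 ≤ j ≤ n` on `[t₁, T)`: critical amplitude times `lam^{19j/5} ≤ lam^{19n/5}`
  have hsplit : lam ^ ((4 : ℝ) * j) = lam ^ ((19 / 5 : ℝ) * j) * lam ^ ((1 / 5 : ℝ) * j) := by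
    rw [← Real.rpow_add hlam0]
    congr 1
    ring
  have h1 : lam ^ ((19 / 5 : ℝ) * j) ≤ lam ^ ((19 / 5 : ℝ) * n) :=
    Real.rpow_le_rpow_of_exponent_le hlam.le (by
      have : (j : ℝ) ≤ n := by exact_mod_cast hj
      linarith)
  have h2 : lam ^ ((1 / 5 : ℝ) * j) * |X i j t| ≤ max A 0 := (hA t ht i j).trans (le_max_left _ _)
  calc lam ^ ((4 : ℝ) * j) * |X i j t|
      = lam ^ ((19 / 5 : ℝ) * j) * (lam ^ ((1 / 5 : ℝ) * j) * |X i j t|) := by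
        rw [hsplit, mul_assoc]
    _ ≤ lam ^ ((19 / 5 : ℝ) * n) * max A 0 :=
        mul_le_mul h1 h2 (by positivity) (Real.rpow_pos_of_pos hlam0 _).le
    _ ≤ _ := le_max_right _ _

end Summit.NavierStokesRegularity.NavierStokesRegularity.Theorems.PerpetualPumpCircuitTrace

end
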